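import Literature.NumberTheory.LFunctions.Zhang2022.DHMenuConsistentProof

/-!
# Zhang (2022), rung F-S3, family B-dh — row dhE-02′: the menu row of BGTZ Theorem 1.3 re-pointed to the REFEREED
# statement `BGTZ2025.theorem13'` (Proc. AMS 154 (2026)), rendered over the world and met by `W(D, χ)` (companion)

Y. Zhang, *Discrete mean estimates and the Landau–Siegel zero*, arXiv:2211.02515v1 [Zhang2022LandauSiegel] — an unrefereed
manuscript under adjudication. **The programme SEARCHES and TYPES; no claim about Landau–Siegel zeros, Theorems 1–2 of
arXiv:2211.02515 or a repaired Margin232 until a kernel theorem says so.** Nothing in this file is a statement about a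
Dirichlet `L`-function: `DH.world D χ` is the cell's explicit CONSISTENCY WORLD (abstract zero/value/prime-count DATA,
`DHChainBarrier`, p461081/p461386) and every theorem below is elementary bookkeeping about that data. Cell `landau-siegel`
(pub/landau-siegel/), sub-cells B-dh / C / E; written by ls-Bdh-typer-1 g4 as the successor action recorded by the family
planner (B-dh/EDLIST.md v1.6.4–v1.6.7 CHANGELOG, ls-Bdh-plan g2 2026-08-27T01:19:19Z (ii) and 01:32Z: «if §E wants the
word's menu to name the refereed decl, re-render row02′ over `theorem13M'` with the identical vacuity proof (S)»), after
sub-cell C landed the refereed statement (`BGTZ2025.theorem13'`, p483156, ls-lit-r3 g3; REF-C pre-check / post-landing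
sweep PASS 01:30:31Z / 01:32:38Z).

## Why this file exists (provenance erratum of record)

The word's menu `ZeroWorld.Menu` (`DHChainBarrier` :133) renders, as its field `row02` (dhE-02), the tree's named fact
`BGTZ2025.theorem13` — which transcribes Theorem 1.3 of Benli–Goel–Twiss–Zaman in its **arXiv v1/v2** form, with
`K = 10²⁵A²⁰B⁻²e^{8(log q)^{3/4}}(log q)²⁸` in `M = K q^{8θ+2ε}T^{4θ}`. The REFEREED version (arXiv:2410.06082v3 = Proc.
Amer. Math. Soc. **154** (2026), no. 2, 509–525) prints the same theorem with
`K = (3 × 10¹⁶)A⁸B⁻²e^{8(log q)^{3/4}}(log(14A²q³))²⁴(log q)⁴`, all other binders and the conclusion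
`β < 1 − log(θ/(4(1 − β₁) log M))/log M` unchanged [cite: BenliGoelTwissZaman2025, Theorem 1.3 (1.5), arXiv v3]; neither
`K` dominates the other on the whole parameter range (`ExplicitDeuringHeilbronnDirichlet` module docstring, ERRATUM
2026-08-27), so §C vendored the refereed statement under the primed names `BGTZ2025.theorem13K'` / `theorem13M'` /
`theorem13'` (p483156) and re-tagged `theorem13` as a superseded preprint claim. The word's object is untouched by this file
(no pen on `DHChainBarrier.lean`: `Menu`, `MenuConsistent` and `menuConsistent_holds` p468827 stand as they are).

## What is typed and proved here

* `ZeroWorld.row02' w : Prop` — the field `Menu.row02` with `BGTZ2025.theorem13M` replaced by `BGTZ2025.theorem13M'`,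
  i.e. the refereed `BGTZ2025.theorem13'` read VERBATIM over the world (`L(ρ,χ) = 0 ↦ w.IsZero q χ ρ`,
  `BGTZ2025.HypothesisA ↦ w.hypothesisA`; binders `q > 4·10⁵`, `T ≥ 4`, `A, B ≥ 1`, `0 < θ ≤ ¼`, `0 < ε ≤ ½`,
  `1 − 1/(10 log q) < β₁ < 1 − B/(q^ε (log q)²)`, `ρ ≠ 1`, `ρ ≠ β₁`, `½ < Re ρ` STRICT, `|Im ρ| ≤ T` — byte-identical to
  `row02` but for the name of `M`).
* `world_row02'` — **VACUOUS on `W(D, χ)` for every `log D ≥ 43 250`**, by the proof of `world_row02`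
  (`DHMenuConsistentP4` :302) copied verbatim: a zero `ρ` of the world with `Re ρ > ½` is `β₁(D)` on an induced slot
  (`re_gt_half_zero`), and so is the real zero `β₁` of the hypothesis (`real_zero_gt_half`, `half_lt_of_window`), whence
  `ρ = β₁`, contradicting the binder `ρ ≠ β₁`; `K′`, `M′` are never read (ls-Bdh-plan g2 term-(iii) screen 01:19:19Z:
  «VACUOUS on W for ANY K»).
* `MenuRow02PrimeConsistent : Prop` — for every modulus `D` with `log D ≥ 43 250` and every primitive quadratic `χ ≠ χ₀`
  mod `D`: `(world D χ).Menu D χ ∧ (world D χ).row02'` — the word's typed menu TOGETHER WITH the re-pointed row, met by the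
  SAME world; and `menuRow02PrimeConsistent_holds : MenuRow02PrimeConsistent` from `menuConsistent_holds` (p468827) and
  `world_row02'`.
* `Menu.row02_iff_row02'_on_world` is NOT claimed: the two rows differ as statements (different `M`); only their truth
  value on `W` coincides (both vacuous), which is what `world_row02` / `world_row02'` record.

## Scope (this file moves no word)

WORD OF RECORD «KILL(B-dh) inside Σ_menu» = `DH.certificate_holds` conjuncts 1–2 (p478764), over `M_typed ∪ M_primes`
AS TYPED at 2026-08-26T19:31:07Z — its row dhE-02 names `BGTZ2025.theorem13` (v2 form) and is vacuous on `W`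
(`world_row02`); B-dh term-(iii) screen: NO RE-OPENING (EDLIST v1.6.4/v1.6.7). This companion says only: the same world
ALSO meets the row re-pointed to the print fact, jointly with the whole typed menu — so a done-condition that prefers to
name the refereed decl may conjoin `MenuRow02PrimeConsistent` (fed by `menuRow02PrimeConsistent_holds`) at
ls-barrier-plan's discretion; nothing here requires it. No new named fact (D-0026: 0 unproved `def … : Prop`; the one
`Prop` definition is discharged in this file). No instance, no notation.

«The programme SEARCHES and TYPES; no claim about Landau–Siegel zeros, Theorems 1–2 of arXiv:2211.02515 or a repaired
Margin232 until a kernel theorem says so.»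

## References

* [Zhang2022LandauSiegel] Y. Zhang, *Discrete mean estimates and the Landau–Siegel zero*, arXiv:2211.02515v1 (2022), §2
  Assumption (A).
* [BenliGoelTwissZaman2025] K. Benli, S. Goel, H. Twiss, A. Zaman, *Explicit Deuring–Heilbronn phenomenon for Dirichlet
  `L`-functions*, Proc. Amer. Math. Soc. **154** (2026), no. 2, 509–525 = arXiv:2410.06082v3, Theorem 1.3 and (1.5)
  (tree: `BGTZ2025.theorem13'`, `theorem13K'`, `theorem13M'`, `ExplicitDeuringHeilbronnDirichlet.lean` p483156); arXiv v2
  form = `BGTZ2025.theorem13` (superseded, claim-tagged).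
* Tree: `Zhang2022/DHChainBarrier.lean` (`ZeroWorld.Menu.row02`, `MenuConsistent`), `Zhang2022/DHMenuConsistentP4.lean`
  (`world_row02`, `re_gt_half_zero`, `real_zero_gt_half`, `half_lt_of_window`), `Zhang2022/DHMenuConsistentProof.lean`
  (`menuConsistent_holds` p468827).
* pub/landau-siegel/B-dh/EDLIST.md v1.6.7 CHANGELOG (row dhE-02); STATUS 2026-08-27T01:30:31Z / 01:32:38Z (REF-C).
-/

noncomputable section

open scoped Classical
open Complex

namespace Literature.NumberTheory.LFunctions.Zhang2022.DH

/-! ## 1. The re-pointed row over an abstract world -/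

namespace ZeroWorld

/-- **dhE-02′ = `BGTZ2025.theorem13'` (Theorem 1.3, REFEREED form) verbatim over the world**: the field `Menu.row02` with
the refereed `M′ = K′ q^{8θ+2ε} T^{4θ}`, `K′ = (3 × 10¹⁶)A⁸B⁻²e^{8(log q)^{3/4}}(log(14A²q³))²⁴(log q)⁴`
(`BGTZ2025.theorem13M'`) in place of the arXiv-v2 `M` (`BGTZ2025.theorem13M`); every other binder identical.
[cite: BenliGoelTwissZaman2025, Theorem 1.3 (1.5), arXiv:2410.06082v3 = Proc. Amer. Math. Soc. 154 (2026) 509–525] -/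
def row02' (w : ZeroWorld) : Prop :=
  ∀ (q : ℕ) [NeZero q], 400000 < q → ∀ T : ℝ, 4 ≤ T →
    ∀ A B θ ε : ℝ, 1 ≤ A → 1 ≤ B → 0 < θ → θ ≤ 1 / 4 → 0 < ε → ε ≤ 1 / 2 → w.hypothesisA A θ →
      ∀ (χ₁ : DirichletCharacter ℂ q) (β₁ : ℝ), 1 - 1 / (10 * Real.log q) < β₁ →
        β₁ < 1 - B / ((q : ℝ) ^ ε * Real.log q ^ 2) → w.IsZero q χ₁ β₁ →
          ∀ (ψ : DirichletCharacter ℂ q) (ρ : ℂ), ρ ≠ 1 → ρ ≠ (β₁ : ℂ) → w.IsZero q ψ ρ → 1 / 2 < ρ.re → |ρ.im| ≤ T →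
            ρ.re < 1 - Real.log (θ / (4 * (1 - β₁) * Real.log (BGTZ2025.theorem13M' A B θ ε q T))) /
              Real.log (BGTZ2025.theorem13M' A B θ ε q T)

/-- Unfolding lemma for `row02'` (the statement by name is the displayed formula).
[cite: BenliGoelTwissZaman2025, Theorem 1.3, arXiv:2410.06082v3] -/
theorem row02'_iff (w : ZeroWorld) : w.row02' ↔
    ∀ (q : ℕ) [NeZero q], 400000 < q → ∀ T : ℝ, 4 ≤ T →
      ∀ A B θ ε : ℝ, 1 ≤ A → 1 ≤ B → 0 < θ → θ ≤ 1 / 4 → 0 < ε → ε ≤ 1 / 2 → w.hypothesisA A θ →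
        ∀ (χ₁ : DirichletCharacter ℂ q) (β₁ : ℝ), 1 - 1 / (10 * Real.log q) < β₁ →
          β₁ < 1 - B / ((q : ℝ) ^ ε * Real.log q ^ 2) → w.IsZero q χ₁ β₁ →
            ∀ (ψ : DirichletCharacter ℂ q) (ρ : ℂ), ρ ≠ 1 → ρ ≠ (β₁ : ℂ) → w.IsZero q ψ ρ → 1 / 2 < ρ.re →
              |ρ.im| ≤ T →
                ρ.re < 1 - Real.log (θ / (4 * (1 - β₁) * Real.log (BGTZ2025.theorem13M' A B θ ε q T))) /
                  Real.log (BGTZ2025.theorem13M' A B θ ε q T) :=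
  Iff.rfl

end ZeroWorld

/-! ## 2. The companion statement -/

/-- **`MenuRow02PrimeConsistent` (B-DH-W with dhE-02 re-pointed to the print fact; companion).** For every modulus `D` with
`log D ≥ 43 250` and every primitive quadratic `χ ≠ χ₀` mod `D`, the (A)-world `world D χ` satisfies the whole typed menu
`Menu` AND the re-pointed row `row02'` (BGTZ Theorem 1.3 in its refereed form, `BGTZ2025.theorem13'`). A companion of
`MenuConsistent` (which it implies by projection); it moves no word. [cite: Zhang2022LandauSiegel, §2 Assumption (A)] -/
def MenuRow02PrimeConsistent : Prop :=
  ∀ (D : ℕ) [NeZero D] (χ : DirichletCharacter ℂ D), χ.IsPrimitive → χ.IsQuadratic → χ ≠ 1 →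
    (43250 : ℝ) ≤ Real.log D → (world D χ).Menu D χ ∧ (world D χ).row02'

/-- `MenuRow02PrimeConsistent` implies the word's `MenuConsistent` (first projection).
[cite: Zhang2022LandauSiegel, §2 Assumption (A)] -/
theorem MenuRow02PrimeConsistent.menuConsistent (h : MenuRow02PrimeConsistent) : MenuConsistent :=
  fun D _ χ hprim hquad hne hL => (h D χ hprim hquad hne hL).1

/-! ## 3. The re-pointed row on the world: vacuous -/

section World

variable {D : ℕ} {χ : DirichletCharacter ℂ D} (hL : (43250 : ℝ) ≤ Real.log D)
include hL

/-- **Row dhE-02′ on the world (BGTZ Thm. 1.3, refereed form): VACUOUS** — a zero `ρ ≠ β₁` with `Re ρ > ½` does not exist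
in `W(D, χ)`; the proof of `world_row02` verbatim (`K′`, `M′` are never read).
[cite: BenliGoelTwissZaman2025, Theorem 1.3, arXiv:2410.06082v3 = Proc. Amer. Math. Soc. 154 (2026) 509–525] -/
theorem world_row02' : (world D χ).row02' := by
  intro q _ hq T _ A B θ ε _ _ _ _ _ _ _ χ₁ β₁ hlo _ hz1 ψ ρ _ hρβ hz hre _
  exfalso
  obtain ⟨-, rfl⟩ := re_gt_half_zero hL hz hre
  obtain ⟨-, h⟩ := real_zero_gt_half hL hz1 (half_lt_of_window (by omega) hlo)
  exact hρβ (by rw [h])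

end World

/-! ## 4. The companion, discharged -/

/-- **`MenuRow02PrimeConsistent` holds**: the (A)-world meets the typed menu (`menuConsistent_holds`, p468827) and the row
dhE-02 re-pointed to the refereed `BGTZ2025.theorem13'` (`world_row02'`, vacuous), for every `log D ≥ 43 250`. A COMPANION;
the word of record is `DH.certificate_holds` conjuncts 1–2. «The programme SEARCHES and TYPES; no claim about
Landau–Siegel zeros, Theorems 1–2 of arXiv:2211.02515 or a repaired Margin232 until a kernel theorem says so.»
[cite: Zhang2022LandauSiegel, §2 Assumption (A)] -/
theorem menuRow02PrimeConsistent_holds : MenuRow02PrimeConsistent := by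
  intro D _ χ hprim hquad hne hL
  exact ⟨menuConsistent_holds D χ hprim hquad hne hL, world_row02' hL⟩

/-- The referee's C2 probe (REF-E §0b): the proved type is the definition BY NAME. [cite: Zhang2022LandauSiegel, §2 Assumption (A)] -/
example : Literature.NumberTheory.LFunctions.Zhang2022.DH.MenuRow02PrimeConsistent := menuRow02PrimeConsistent_holds

end Literature.NumberTheory.LFunctions.Zhang2022.DH

end
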